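import Literature.AlgebraicGeometry.Resolution.FormalFibresProofs
import Literature.AlgebraicGeometry.Resolution.CoefficientRingsProofs
import Literature.AlgebraicGeometry.Resolution.GenericEtaleSeparable
import Literature.AlgebraicGeometry.Resolution.DerivativeIdealsLocalization
import Literature.AlgebraicGeometry.Motives.VarietiesRegularProofs
import Literature.AlgebraicGeometry.Resolution.CompleteLocalDomainJ0Lemmas
import Mathlib.RingTheory.Localization.LocalizationLocalization
import Mathlib.FieldTheory.PurelyInseparable.Basic
import Mathlib.FieldTheory.SeparableClosure
import HarnessLib

/-!
# Stacks 07PI: a Noetherian complete local domain is J-0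

Topic: `Literature/AlgebraicGeometry/Resolution`. Second ingredient (after the G-ring property,
`Matsumura1987_32_3_holds`, and universal catenarity, `ExcellentRingsCompleteUC.lean`) of the
discharge of the named fact `Stacks07QW_complete` (`ExcellentRings.lean`; Stacks 07QW (2)): the
base case of the J-2 property of complete local rings (Stacks 07PJ (2) reduces, through 07PC and
Nagata's criterion 07P9, to the statement that a Noetherian complete local DOMAIN is J-0).

Stacks, Tag 07PI, printed proof: "we can find a regular subring `A₀ ⊂ A` with `A` finite over
`A₀` [here Matsumura Thm. 29.4 (iii), `Matsumura1987_29_4_iii_holds`]. The induced extension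
`K/K₀` of fraction fields is finite. If `K/K₀` is separable, then we are done by Lemma 07PB
[generic étaleness, `exists_etale_localization_away_of_isSeparable_of_finite`, and étale over
regular is regular, `Literature.AlgebraicGeometry.Motives.IsRegularLocalRing.of_etale`]. If not
… arguing by induction on `[K : K₀]` we may assume there exists `A₀ ⊂ B ⊂ A` such that `B` is
J-0 and `K/M` has no nontrivial subextensions … `K = M[z]/(z^p - b)` … By Lemma 07PH
[`Stacks07PH_finite_regular_holds`] we can find a derivation `D : B → B` with `D(b) ≠ 0`.
Applying Lemma 07PG [`isRegularRing_adjoinRoot_X_pow_sub_C_of_derivation`] we see that `A_𝔭` is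
regular for any prime `𝔭` of `A` lying over a regular prime of `B` and not containing `D(b)`."
We climb, as in `FormalFibresRegularDerivations.lean`, from the separable closure `K_s` of
`K₀ = Frac A₀` in `K = Frac A` through the purely inseparable part by adjoining elements
`x ∈ A` with minimal polynomial `X^{p^m} - a` (any `m`; 07PG holds for all exponents), the rings
along the way being `B_F = A ∩ F` for intermediate fields `F`. Everything is PROVED.

## Content (namespace `Literature.AlgebraicGeometry.Resolution`)

* Setup for `R ⊆ A` finite injective, domains (the rings `A' = Im(A → Frac A)` and
  `B_F = A' ∩ F` are local NOTATION `(IsScalarTower.toAlgHom R A (FractionRing A)).range`, `(((IsScalarTower.toAlgHom R A (FractionRing A)).range ⊓ Subalgebra.restrictScalars R (IntermediateField.toSubalgebra F) : Subalgebra R (FractionRing A)))`, no definitions):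
  `exists_mul_algebraMap_eq_of_finite` (denominators in `R`), `finite_interSubalgebra`,
  `isFractionRing_interSubalgebra` (`Frac B_F = F`), `finiteDimensional_fractionRing_of_finite`.
* `exists_ne_zero_forall_isRegularLocalRing_of_ringEquiv` (J-0 along isomorphisms),
  `isRegularLocalRing_of_etale_away`, the separable step
  `exists_ne_zero_forall_isRegularLocalRing_interSubalgebra_separableClosure`.
* The radical step `exists_ne_zero_forall_isRegularLocalRing_interSubalgebra_adjoin`, with
  `exists_smul_mem_adjoin_interSubalgebra`, `exists_smul_interSubalgebra_adjoin_le` (common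
  denominators).
* The climb `exists_ne_zero_forall_isRegularLocalRing_interSubalgebra_top_of_le`,
  `exists_ne_zero_forall_isRegularLocalRing_of_finite_regular`, and
  **Stacks 07PI** `exists_ne_zero_forall_isRegularLocalRing_of_isAdicComplete`.

## Sources

* The Stacks Project, More on Algebra, Section 07P6 "The singular locus": Tags 07PI, 07PB, 07PG,
  07PH. [StacksProject]
* H. Matsumura, *Commutative Ring Theory*, CUP 1986, Thm. 29.4 (iii), p. 225; §32 p. 260.
  [Matsumura1987]
-/

noncomputable section

open IsLocalRing Polynomial

namespace Literature.AlgebraicGeometry.Resolution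

universe u

section Setup

variable {R A : Type u} [CommRing R] [IsDomain R] [CommRing A] [IsDomain A] [Algebra R A]
  [FaithfulSMul R A] [Algebra (FractionRing R) (FractionRing A)]
  [IsScalarTower R (FractionRing R) (FractionRing A)]

omit [FaithfulSMul R A] [Algebra (FractionRing R) (FractionRing A)] [IsScalarTower R (FractionRing R) (FractionRing A)] in
/-- **Denominators in the small ring**: every element of `Frac A` is `a/s` with `a ∈ A` and
`0 ≠ s ∈ R` (`A` is finite, hence algebraic, over `R`). [folklore] -/
theorem exists_mul_algebraMap_eq_of_finite [Module.Finite R A] (y : FractionRing A) :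
    ∃ a : A, ∃ s : R, s ≠ 0 ∧ y * algebraMap R (FractionRing A) s = algebraMap A (FractionRing A) a := by
  obtain ⟨a₁, a₂, ha₂, rfl⟩ := IsFractionRing.div_surjective (A := A) y
  have ha₂0 : a₂ ≠ 0 := nonZeroDivisors.ne_zero ha₂
  haveI : Algebra.IsIntegral R A := Algebra.IsIntegral.of_finite R A
  have halg : IsAlgebraic R a₂ := (Algebra.IsIntegral.isIntegral (R := R) a₂).isAlgebraic
  obtain ⟨r, hr0, a₃, ha₃⟩ := halg.exists_nonzero_dvd ha₂
  refine ⟨a₁ * a₃, r, hr0, ?_⟩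
  have h2 : algebraMap A (FractionRing A) a₂ ≠ 0 :=
    fun h => ha₂0 ((IsFractionRing.injective A (FractionRing A)) (by rw [h, map_zero]))
  rw [IsScalarTower.algebraMap_apply R A (FractionRing A), ha₃, map_mul, map_mul]
  field_simp

omit [FaithfulSMul R A] in
/-- `B_F` is a finite `R`-module (a submodule of the finite `R`-module `A'`, `R` Noetherian).
[folklore] -/
theorem finite_interSubalgebra [IsNoetherianRing R] [Module.Finite R A]
    (F : IntermediateField (FractionRing R) (FractionRing A)) :
    Module.Finite R ((((IsScalarTower.toAlgHom R A (FractionRing A)).range ⊓ Subalgebra.restrictScalars R (IntermediateField.toSubalgebra F) : Subalgebra R (FractionRing A)))) := by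
  haveI : Module.Finite R ((IsScalarTower.toAlgHom R A (FractionRing A)).range) :=
    Module.Finite.of_surjective
      ((IsScalarTower.toAlgHom R A (FractionRing A)).toLinearMap.rangeRestrict) fun ⟨y, hy⟩ => by
        obtain ⟨a, rfl⟩ := hy
        exact ⟨a, rfl⟩
  haveI : IsNoetherian R ((IsScalarTower.toAlgHom R A (FractionRing A)).range) := isNoetherian_of_isNoetherianRing_of_finite R _
  have hle : (((IsScalarTower.toAlgHom R A (FractionRing A)).range ⊓ Subalgebra.restrictScalars R (IntermediateField.toSubalgebra F) : Subalgebra R (FractionRing A))) ≤ (IsScalarTower.toAlgHom R A (FractionRing A)).range := inf_le_left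
  exact Module.Finite.of_injective (Subalgebra.inclusion hle).toLinearMap
    (Subalgebra.inclusion_injective hle)

/-- `Frac(B_F) = F`: every `y ∈ F ⊆ Frac A` is `a/s` with `a ∈ A`, `s ∈ R ∖ 0`, and then
`a = ys ∈ A ∩ F`. [folklore] -/
theorem isFractionRing_interSubalgebra [Module.Finite R A]
    (F : IntermediateField (FractionRing R) (FractionRing A)) :
    letI := ((show ↥(((IsScalarTower.toAlgHom R A (FractionRing A)).range ⊓ Subalgebra.restrictScalars R (IntermediateField.toSubalgebra F) : Subalgebra R (FractionRing A))) →+* ↥F from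
      { toFun := fun b => ⟨(b : FractionRing A), b.2.2⟩, map_one' := rfl, map_mul' := fun _ _ => rfl,
        map_zero' := rfl, map_add' := fun _ _ => rfl })).toAlgebra
    IsFractionRing ((((IsScalarTower.toAlgHom R A (FractionRing A)).range ⊓ Subalgebra.restrictScalars R (IntermediateField.toSubalgebra F) : Subalgebra R (FractionRing A)))) F := by
  haveI : FaithfulSMul R (FractionRing A) := FractionRing.instFaithfulSMul R A
  letI := ((show ↥(((IsScalarTower.toAlgHom R A (FractionRing A)).range ⊓ Subalgebra.restrictScalars R (IntermediateField.toSubalgebra F) : Subalgebra R (FractionRing A))) →+* ↥F from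
      { toFun := fun b => ⟨(b : FractionRing A), b.2.2⟩, map_one' := rfl, map_mul' := fun _ _ => rfl,
        map_zero' := rfl, map_add' := fun _ _ => rfl })).toAlgebra
  refine ⟨?_, ?_, ?_⟩
  · rintro ⟨b, hb⟩
    refine IsUnit.mk0 _ fun h => nonZeroDivisors.ne_zero hb ?_
    have h' : (((show ↥(((IsScalarTower.toAlgHom R A (FractionRing A)).range ⊓ Subalgebra.restrictScalars R (IntermediateField.toSubalgebra F) : Subalgebra R (FractionRing A))) →+* ↥F from
      { toFun := fun b => ⟨(b : FractionRing A), b.2.2⟩, map_one' := rfl, map_mul' := fun _ _ => rfl,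
        map_zero' := rfl, map_add' := fun _ _ => rfl }) b : F) : FractionRing A) = 0 := by
      rw [show (algebraMap _ F b) = (show ↥(((IsScalarTower.toAlgHom R A (FractionRing A)).range ⊓ Subalgebra.restrictScalars R (IntermediateField.toSubalgebra F) : Subalgebra R (FractionRing A))) →+* ↥F from
      { toFun := fun b => ⟨(b : FractionRing A), b.2.2⟩, map_one' := rfl, map_mul' := fun _ _ => rfl,
        map_zero' := rfl, map_add' := fun _ _ => rfl }) b from rfl] at h
      rw [h]; rfl
    exact Subtype.ext h'
  · rintro ⟨y, hy⟩
    obtain ⟨a, s, hs0, hys⟩ := exists_mul_algebraMap_eq_of_finite (R := R) y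
    have hsF : algebraMap R (FractionRing A) s ∈ F := by
      rw [IsScalarTower.algebraMap_apply R (FractionRing R) (FractionRing A)]
      exact F.algebraMap_mem _
    have haF : algebraMap A (FractionRing A) a ∈ F := by
      rw [← hys]
      exact F.mul_mem hy hsF
    refine ⟨⟨⟨algebraMap A (FractionRing A) a, ⟨a, rfl⟩, haF⟩,
      ⟨⟨algebraMap R (FractionRing A) s, Subalgebra.algebraMap_mem _ s⟩,
        mem_nonZeroDivisors_of_ne_zero fun h => hs0 ?_⟩⟩, ?_⟩
    · have h' : algebraMap R (FractionRing A) s = 0 := congrArg Subtype.val h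
      exact (FaithfulSMul.algebraMap_injective R (FractionRing A)) (by rw [h', map_zero])
    · apply Subtype.ext
      exact hys
  · intro b₁ b₂ h
    refine ⟨1, ?_⟩
    have : (b₁ : FractionRing A) = b₂ := congrArg (fun z : F => (z : FractionRing A)) h
    rw [Subtype.ext this]

end Setup

/-! ## J-0 along isomorphisms; the separable step -/

section Separable

/-- The J-0 property (in the basic-open form) transfers along ring isomorphisms. [folklore] -/
theorem exists_ne_zero_forall_isRegularLocalRing_of_ringEquiv {X Y : Type u} [CommRing X]
    [CommRing Y] (e : X ≃+* Y)
    (h : ∃ f : X, f ≠ 0 ∧ ∀ (Q : Ideal X) [Q.IsPrime], f ∉ Q →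
      IsRegularLocalRing (Localization.AtPrime Q)) :
    ∃ f : Y, f ≠ 0 ∧ ∀ (Q : Ideal Y) [Q.IsPrime], f ∉ Q →
      IsRegularLocalRing (Localization.AtPrime Q) := by
  obtain ⟨f, hf0, hf⟩ := h
  refine ⟨e f, (map_ne_zero_iff _ e.injective).mpr hf0, fun Q _ hfQ => ?_⟩
  haveI : (Q.comap e).IsPrime := Ideal.comap_isPrime _ _
  haveI := hf (Q.comap e) hfQ
  exact IsRegularLocalRing.of_ringEquiv
    (IsLocalization.ringEquivOfRingEquiv (Localization.AtPrime (Q.comap e))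
      (Localization.AtPrime Q) e (e.map_primeCompl_comap_eq Q))

variable {R A : Type u} [CommRing R] [IsDomain R] [CommRing A] [IsDomain A]
  [Algebra R A] [FaithfulSMul R A] [Module.Finite R A] [Algebra (FractionRing R) (FractionRing A)]
  [IsScalarTower R (FractionRing R) (FractionRing A)]


omit [IsDomain R] in
/-- **Étale over regular after a basic open: local rings at primes missing `b` are regular.** If
`B[1/b]` is étale over the regular ring `R`, then `B_Q` is regular for every prime `Q ∌ b`.
[cite: StacksProject, Tag 07PB] -/
theorem isRegularLocalRing_of_etale_away {B : Type u} [CommRing B] [Algebra R B] [IsRegularRing R]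
    {b : B} (hb : Algebra.Etale R (Localization.Away b)) (Q : Ideal B) [Q.IsPrime] (hbQ : b ∉ Q) :
    IsRegularLocalRing (Localization.AtPrime Q) := by
  set L := Localization.Away b with hL
  have hdisj : Disjoint ((Submonoid.powers b : Submonoid B) : Set B) Q := by
    refine Set.disjoint_left.mpr ?_
    rintro _ ⟨n, rfl⟩ h
    exact hbQ (‹Q.IsPrime›.mem_of_pow_mem n h)
  set Q' : Ideal L := Q.map (algebraMap B L) with hQ'
  haveI hQ'p : Q'.IsPrime := IsLocalization.isPrime_of_isPrime_disjoint (Submonoid.powers b) L Q ‹_› hdisj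
  have hcomap : Q'.comap (algebraMap B L) = Q :=
    IsLocalization.under_map_of_isPrime_disjoint (Submonoid.powers b) L ‹_› hdisj
  have hreg : IsRegularLocalRing (Localization.AtPrime Q') :=
    Literature.AlgebraicGeometry.Motives.IsRegularLocalRing.of_etale (R := R) (S := L) Q'
  have h1 : IsLocalization (Q'.comap (algebraMap B L)).primeCompl (Localization.AtPrime Q') :=
    IsLocalization.isLocalization_isLocalization_atPrime_isLocalization (Submonoid.powers b)
      (Localization.AtPrime Q') Q'
  have h2 : (Q'.comap (algebraMap B L)).primeCompl = Q.primeCompl :=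
    Submonoid.ext fun x => by
      show x ∉ Q'.comap (algebraMap B L) ↔ x ∉ Q
      rw [hcomap]
  rw [h2] at h1
  haveI := h1
  exact IsRegularLocalRing.of_ringEquiv
    (IsLocalization.algEquiv Q.primeCompl (Localization.AtPrime Q') (Localization.AtPrime Q)).toRingEquiv

/-- **The separable step of Stacks 07PI**: `B_s = A ∩ K_s` is J-0, where `K_s` is the separable
closure of `Frac R` in `Frac A` — `B_s` is finite over the regular ring `R` with separable
fraction field extension, hence étale over `R` on a non-empty basic open (generic étaleness), and
étale over regular is regular. [cite: StacksProject, Tag 07PI] -/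
theorem exists_ne_zero_forall_isRegularLocalRing_interSubalgebra_separableClosure
    [IsRegularRing R] :
    ∃ f : (((IsScalarTower.toAlgHom R A (FractionRing A)).range ⊓ Subalgebra.restrictScalars R (IntermediateField.toSubalgebra (separableClosure (FractionRing R) (FractionRing A))) : Subalgebra R (FractionRing A))), f ≠ 0 ∧
      ∀ (Q : Ideal ((((IsScalarTower.toAlgHom R A (FractionRing A)).range ⊓ Subalgebra.restrictScalars R (IntermediateField.toSubalgebra (separableClosure (FractionRing R) (FractionRing A))) : Subalgebra R (FractionRing A)))))
        [Q.IsPrime], f ∉ Q → IsRegularLocalRing (Localization.AtPrime Q) := by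
  set F := separableClosure (FractionRing R) (FractionRing A) with hF
  set B := (((IsScalarTower.toAlgHom R A (FractionRing A)).range ⊓ Subalgebra.restrictScalars R (IntermediateField.toSubalgebra F) : Subalgebra R (FractionRing A))) with hB
  letI : Algebra B F := ((show ↥(((IsScalarTower.toAlgHom R A (FractionRing A)).range ⊓ Subalgebra.restrictScalars R (IntermediateField.toSubalgebra F) : Subalgebra R (FractionRing A))) →+* ↥F from
      { toFun := fun b => ⟨(b : FractionRing A), b.2.2⟩, map_one' := rfl, map_mul' := fun _ _ => rfl,
        map_zero' := rfl, map_add' := fun _ _ => rfl })).toAlgebra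
  haveI : IsFractionRing B F := isFractionRing_interSubalgebra F
  haveI : Module.Finite R B := finite_interSubalgebra F
  haveI : IsScalarTower R B F := IsScalarTower.of_algebraMap_eq fun s => Subtype.ext rfl
  obtain ⟨b, hb0, hetale⟩ :=
    exists_etale_localization_away_of_isSeparable_of_finite R B (FractionRing R) F
  exact ⟨b, hb0, fun Q _ hbQ => isRegularLocalRing_of_etale_away hetale Q hbQ⟩

end Separable

/-! ## The radical step -/

section Radical

variable {R A : Type u} [CommRing R] [IsDomain R] [CommRing A] [IsDomain A]
  [Algebra R A] [FaithfulSMul R A] [Module.Finite R A] [Algebra (FractionRing R) (FractionRing A)]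
  [IsScalarTower R (FractionRing R) (FractionRing A)]


omit [FaithfulSMul R A] in
/-- **Denominators for `F(x)`**: if `x ∈ Frac A` is integral over the intermediate field `F`, then
every element of `F(x)` becomes, after multiplication by some `0 ≠ s ∈ R`, a polynomial in `x`
with coefficients in `B_F = A ∩ F` (write it as `q(x)` with `q ∈ F[X]` and clear the finitely
many denominators of the coefficients, which lie in `F = Frac B_F`). [folklore] -/
theorem exists_smul_mem_adjoin_interSubalgebra (F : IntermediateField (FractionRing R) (FractionRing A))
    {x : FractionRing A} (hx : IsIntegral F x) {y : FractionRing A}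
    (hy : y ∈ IntermediateField.adjoin F {x}) :
    ∃ s : R, s ≠ 0 ∧ algebraMap R (FractionRing A) s * y ∈
      Algebra.adjoin ((((IsScalarTower.toAlgHom R A (FractionRing A)).range ⊓ Subalgebra.restrictScalars R (IntermediateField.toSubalgebra F) : Subalgebra R (FractionRing A)))) {x} := by
  classical
  -- `y = q(x)` with `q ∈ F[X]`
  have hy' : y ∈ Algebra.adjoin F {x} := by
    rw [← IntermediateField.adjoin_simple_toSubalgebra_of_isAlgebraic hx.isAlgebraic]
    exact hy
  obtain ⟨q, hq⟩ := Algebra.adjoin_mem_exists_aeval F x hy'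
  -- denominators of the coefficients
  have hcoeff : ∀ n : ℕ, ∃ a : A, ∃ s : R, s ≠ 0 ∧
      ((q.coeff n : F) : FractionRing A) * algebraMap R (FractionRing A) s =
        algebraMap A (FractionRing A) a := fun n =>
    exists_mul_algebraMap_eq_of_finite (R := R) _
  choose a sf hsf0 hsf using hcoeff
  set s := ∏ n ∈ q.support, sf n with hs
  have hs0 : s ≠ 0 := Finset.prod_ne_zero_iff.mpr fun n _ => hsf0 n
  refine ⟨s, hs0, ?_⟩
  -- `s • q` has coefficients in `C = A ∩ F`
  letI : Algebra ((((IsScalarTower.toAlgHom R A (FractionRing A)).range ⊓ Subalgebra.restrictScalars R (IntermediateField.toSubalgebra F) : Subalgebra R (FractionRing A)))) F := ((show ↥(((IsScalarTower.toAlgHom R A (FractionRing A)).range ⊓ Subalgebra.restrictScalars R (IntermediateField.toSubalgebra F) : Subalgebra R (FractionRing A))) →+* ↥F from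
      { toFun := fun b => ⟨(b : FractionRing A), b.2.2⟩, map_one' := rfl, map_mul' := fun _ _ => rfl,
        map_zero' := rfl, map_add' := fun _ _ => rfl })).toAlgebra
  haveI : IsScalarTower ((((IsScalarTower.toAlgHom R A (FractionRing A)).range ⊓ Subalgebra.restrictScalars R (IntermediateField.toSubalgebra F) : Subalgebra R (FractionRing A)))) F (FractionRing A) :=
    IsScalarTower.of_algebraMap_eq fun c => rfl
  have hmemC : ∀ n, algebraMap A (FractionRing A) (a n) ∈ (((IsScalarTower.toAlgHom R A (FractionRing A)).range ⊓ Subalgebra.restrictScalars R (IntermediateField.toSubalgebra F) : Subalgebra R (FractionRing A))) := fun n =>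
    ⟨⟨a n, rfl⟩, by
      show algebraMap A (FractionRing A) (a n) ∈ F
      rw [← hsf n, IsScalarTower.algebraMap_apply R (FractionRing R) (FractionRing A)]
      exact F.mul_mem (q.coeff n).2 (F.algebraMap_mem _)⟩
  have hlift : (algebraMap R F s) • q ∈ Polynomial.lifts (algebraMap ((((IsScalarTower.toAlgHom R A (FractionRing A)).range ⊓ Subalgebra.restrictScalars R (IntermediateField.toSubalgebra F) : Subalgebra R (FractionRing A)))) F) := by
    rw [Polynomial.lifts_iff_coeff_lifts]
    intro n
    rw [Polynomial.coeff_smul, smul_eq_mul]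
    by_cases hn : n ∈ q.support
    · -- `s = sf n * s'`
      obtain ⟨s', hs'⟩ : ∃ s', s = sf n * s' :=
        ⟨∏ m ∈ q.support.erase n, sf m, (Finset.mul_prod_erase _ _ hn).symm⟩
      refine ⟨algebraMap R _ s' * ⟨algebraMap A (FractionRing A) (a n), hmemC n⟩, ?_⟩
      apply Subtype.ext
      show algebraMap R (FractionRing A) s' * algebraMap A (FractionRing A) (a n) =
        ((algebraMap R F s * q.coeff n : F) : FractionRing A)
      rw [← hsf n, hs']
      show algebraMap R (FractionRing A) s' *
          (((q.coeff n : F) : FractionRing A) * algebraMap R (FractionRing A) (sf n)) =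
        algebraMap R (FractionRing A) (sf n * s') * ((q.coeff n : F) : FractionRing A)
      rw [map_mul]
      ring
    · rw [Polynomial.notMem_support_iff.mp hn, mul_zero]
      exact ⟨0, map_zero _⟩
  obtain ⟨q₀, hq₀⟩ := (Polynomial.mem_lifts _).mp hlift
  -- `s y = q₀(x)`
  haveI : IsScalarTower R F (FractionRing A) := IsScalarTower.of_algebraMap_eq fun r => rfl
  have h1 : algebraMap R (FractionRing A) s * y = Polynomial.aeval x ((algebraMap R F s) • q) := by
    rw [map_smul, ← hq, Algebra.smul_def, IsScalarTower.algebraMap_apply R F (FractionRing A)]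
  rw [h1, ← hq₀, Polynomial.aeval_map_algebraMap]
  exact Polynomial.aeval_mem_adjoin_singleton _ x

omit [FaithfulSMul R A] in
/-- **A common denominator for `A ∩ F(x)`**: some `0 ≠ s ∈ R` multiplies all of
`B_{F(x)} = A ∩ F(x)` into `B_F[x]` (`B_{F(x)}` is a finite `R`-module). [folklore] -/
theorem exists_smul_interSubalgebra_adjoin_le [IsNoetherianRing R]
    (F : IntermediateField (FractionRing R) (FractionRing A)) {x : FractionRing A}
    (hx : IsIntegral F x) :
    ∃ s : R, s ≠ 0 ∧ ∀ y ∈ (((IsScalarTower.toAlgHom R A (FractionRing A)).range ⊓ Subalgebra.restrictScalars R (IntermediateField.toSubalgebra ((IntermediateField.adjoin F {x}).restrictScalars (FractionRing R))) : Subalgebra R (FractionRing A))),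
      algebraMap R (FractionRing A) s * y ∈ Algebra.adjoin ((((IsScalarTower.toAlgHom R A (FractionRing A)).range ⊓ Subalgebra.restrictScalars R (IntermediateField.toSubalgebra F) : Subalgebra R (FractionRing A)))) {x} := by
  classical
  set C' := (((IsScalarTower.toAlgHom R A (FractionRing A)).range ⊓ Subalgebra.restrictScalars R (IntermediateField.toSubalgebra ((IntermediateField.adjoin F {x}).restrictScalars (FractionRing R))) : Subalgebra R (FractionRing A)))
    with hC'
  haveI : Module.Finite R C' := finite_interSubalgebra _
  obtain ⟨T, hT⟩ := Module.Finite.fg_top (R := R) (M := C')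
  have hgen : ∀ t : C', ∃ s : R, s ≠ 0 ∧
      algebraMap R (FractionRing A) s * (t : FractionRing A) ∈
        Algebra.adjoin ((((IsScalarTower.toAlgHom R A (FractionRing A)).range ⊓ Subalgebra.restrictScalars R (IntermediateField.toSubalgebra F) : Subalgebra R (FractionRing A)))) {x} := fun t =>
    exists_smul_mem_adjoin_interSubalgebra F hx
      ((IntermediateField.mem_restrictScalars (FractionRing R)).mp t.2.2)
  choose sf hsf0 hsf using hgen
  refine ⟨∏ t ∈ T, sf t, Finset.prod_ne_zero_iff.mpr fun t _ => hsf0 t, fun y hy => ?_⟩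
  -- induction over the `R`-span of `T`
  have hy' : (⟨y, hy⟩ : C') ∈ Submodule.span R (T : Set C') := by rw [hT]; trivial
  suffices H : ∀ z : C', z ∈ Submodule.span R (T : Set C') →
      algebraMap R (FractionRing A) (∏ t ∈ T, sf t) * (z : FractionRing A) ∈
        Algebra.adjoin ((((IsScalarTower.toAlgHom R A (FractionRing A)).range ⊓ Subalgebra.restrictScalars R (IntermediateField.toSubalgebra F) : Subalgebra R (FractionRing A)))) {x} from H ⟨y, hy⟩ hy'
  intro z hz
  induction hz using Submodule.span_induction with
  | mem t ht =>
    obtain ⟨s', hs'⟩ : ∃ s', ∏ t ∈ T, sf t = sf t * s' :=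
      ⟨∏ m ∈ T.erase t, sf m, (Finset.mul_prod_erase _ _ ht).symm⟩
    rw [hs', map_mul, mul_comm (algebraMap R _ (sf t)), mul_assoc]
    refine Subalgebra.mul_mem _ ?_ (hsf t)
    exact Subalgebra.algebraMap_mem _
      (⟨algebraMap R (FractionRing A) s', Subalgebra.algebraMap_mem _ s'⟩ :
        (((IsScalarTower.toAlgHom R A (FractionRing A)).range ⊓ Subalgebra.restrictScalars R (IntermediateField.toSubalgebra F) : Subalgebra R (FractionRing A))))
  | zero => simp
  | add z w _ _ hz hw =>
    rw [Subalgebra.coe_add, mul_add]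
    exact Subalgebra.add_mem _ hz hw
  | smul r z _ hz =>
    have hrz : ((r • z : _) : FractionRing A) =
        algebraMap R (FractionRing A) r * (z : FractionRing A) := by
      rw [Algebra.smul_def]; rfl
    rw [hrz, mul_left_comm]
    refine Subalgebra.mul_mem _ ?_ hz
    exact Subalgebra.algebraMap_mem _
      (⟨algebraMap R (FractionRing A) r, Subalgebra.algebraMap_mem _ r⟩ :
        (((IsScalarTower.toAlgHom R A (FractionRing A)).range ⊓ Subalgebra.restrictScalars R (IntermediateField.toSubalgebra F) : Subalgebra R (FractionRing A))))

set_option maxHeartbeats 800000 in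
set_option synthInstance.maxHeartbeats 200000 in
/-- **The radical step of Stacks 07PI.** Let `F` be an intermediate field of `Frac A / Frac R`
with `B_F = A ∩ F` J-0, and `x ∈ A` (inside `Frac A`) with minimal polynomial `X^{p^m} - a` over
`F`, `a` not a `p`-th power in `F`. Then `B_{F(x)}` is J-0. Printed proof: by Stacks 07PH there is
a derivation `D` of `B = B_F` with `D(a) ≠ 0` (`Stacks07PH_finite_regular_holds`); after inverting
`h = g · D(a)` (`g` a J-0 witness) `B_h` is a regular ring carrying the extension of `D` with
`D(a)` a unit, so `B_h[z]/(z^{p^m} - a)` is regular (Stacks 07PG,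
`isRegularRing_adjoinRoot_X_pow_sub_C_of_derivation`); and `B_{F(x)}` agrees with
`B[x] ≅ B[z]/(z^{p^m} - a)` after inverting a common denominator, so its local rings at primes
missing `h` and that denominator are localisations of this regular ring.
[cite: StacksProject, Tag 07PI] -/
theorem exists_ne_zero_forall_isRegularLocalRing_interSubalgebra_adjoin
    [IsRegularLocalRing R] [IsAdicComplete (maximalIdeal R) R] (p : ℕ) [Fact p.Prime]
    [CharP (FractionRing A) p] (F : IntermediateField (FractionRing R) (FractionRing A))
    (hJ0 : ∃ g : (((IsScalarTower.toAlgHom R A (FractionRing A)).range ⊓ Subalgebra.restrictScalars R (IntermediateField.toSubalgebra F) : Subalgebra R (FractionRing A))), g ≠ 0 ∧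
      ∀ (Q : Ideal ((((IsScalarTower.toAlgHom R A (FractionRing A)).range ⊓ Subalgebra.restrictScalars R (IntermediateField.toSubalgebra F) : Subalgebra R (FractionRing A))))) [Q.IsPrime], g ∉ Q →
        IsRegularLocalRing (Localization.AtPrime Q))
    {x : FractionRing A} (hxA : x ∈ (IsScalarTower.toAlgHom R A (FractionRing A)).range) (m : ℕ) (a : F)
    (hmin : minpoly F x = X ^ (p ^ m) - Polynomial.C a) (ha : ∀ c : F, c ^ p ≠ a) :
    ∃ g : (((IsScalarTower.toAlgHom R A (FractionRing A)).range ⊓ Subalgebra.restrictScalars R (IntermediateField.toSubalgebra ((IntermediateField.adjoin F {x}).restrictScalars (FractionRing R))) : Subalgebra R (FractionRing A))),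
      g ≠ 0 ∧ ∀ (Q : Ideal ((((IsScalarTower.toAlgHom R A (FractionRing A)).range ⊓ Subalgebra.restrictScalars R (IntermediateField.toSubalgebra ((IntermediateField.adjoin F {x}).restrictScalars (FractionRing R))) : Subalgebra R (FractionRing A))))) [Q.IsPrime],
        g ∉ Q → IsRegularLocalRing (Localization.AtPrime Q) := by
  haveI : FaithfulSMul R (FractionRing A) := FractionRing.instFaithfulSMul R A
  classical
  have hp : p.Prime := Fact.out
  set C := (((IsScalarTower.toAlgHom R A (FractionRing A)).range ⊓ Subalgebra.restrictScalars R (IntermediateField.toSubalgebra F) : Subalgebra R (FractionRing A))) with hCdef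
  set F' := (IntermediateField.adjoin F {x}).restrictScalars (FractionRing R) with hF'def
  set C' := (((IsScalarTower.toAlgHom R A (FractionRing A)).range ⊓ Subalgebra.restrictScalars R (IntermediateField.toSubalgebra F') : Subalgebra R (FractionRing A))) with hC'def
  -- structures on `C = B_F`
  letI algCF : Algebra C F := ((show ↥(((IsScalarTower.toAlgHom R A (FractionRing A)).range ⊓ Subalgebra.restrictScalars R (IntermediateField.toSubalgebra F) : Subalgebra R (FractionRing A))) →+* ↥F from
      { toFun := fun b => ⟨(b : FractionRing A), b.2.2⟩, map_one' := rfl, map_mul' := fun _ _ => rfl,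
        map_zero' := rfl, map_add' := fun _ _ => rfl })).toAlgebra
  haveI : IsFractionRing C F := isFractionRing_interSubalgebra F
  haveI : Module.Finite R C := finite_interSubalgebra F
  haveI : IsScalarTower C F (FractionRing A) := IsScalarTower.of_algebraMap_eq fun _ => rfl
  haveI : IsScalarTower R F (FractionRing A) := IsScalarTower.of_algebraMap_eq fun _ => rfl
  haveI : IsNoetherianRing C := Algebra.FiniteType.isNoetherianRing R C
  haveI : CharP C p := (algebraMap C (FractionRing A)).charP Subtype.val_injective p
  -- `x` is integral, `x^{p^m} = a ∈ A ∩ F`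
  have hxint : IsIntegral F x := by
    by_contra h
    rw [minpoly.eq_zero h] at hmin
    exact (Polynomial.X_pow_sub_C_ne_zero (pow_pos hp.pos m) a) hmin.symm
  have haK : x ^ (p ^ m) = ((a : F) : (FractionRing A)) := by
    have h := minpoly.aeval F x
    rw [hmin, map_sub, map_pow, Polynomial.aeval_X, Polynomial.aeval_C, sub_eq_zero] at h
    exact h
  have hamem : ((a : F) : (FractionRing A)) ∈ C :=
    ⟨by rw [← haK]; exact Subalgebra.pow_mem _ hxA _, a.2⟩
  set a₀ : C := ⟨(a : (FractionRing A)), hamem⟩ with ha₀def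
  have ha₀F : algebraMap C F a₀ = a := Subtype.ext rfl
  -- Stacks 07PH: a derivation with `D a ≠ 0`
  have hinjRC : Function.Injective (algebraMap R C) := fun r₁ r₂ h =>
    FaithfulSMul.algebraMap_injective R (FractionRing A) (congrArg Subtype.val h)
  have hnot : ∀ y : FractionRing C, y ^ p ≠ algebraMap C (FractionRing C) a₀ := by
    intro y hy
    let e : FractionRing C ≃ₐ[C] F := IsLocalization.algEquiv (nonZeroDivisors C) _ _
    apply ha (e y)
    rw [← map_pow, hy, AlgEquiv.commutes, ha₀F]
  letI intAlgC : Algebra ℤ C := Ring.toIntAlgebra _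
  letI intModC : Module ℤ C := AddCommGroup.toIntModule _
  obtain ⟨D, hD⟩ := Stacks07PH_finite_regular_holds p R C hinjRC a₀ hnot
  -- invert `h = g · D a`
  obtain ⟨g, hg0, hg⟩ := hJ0
  set h := g * D a₀ with hhdef
  have hh0 : h ≠ 0 := mul_ne_zero hg0 hD
  set Cₕ := Localization.Away h with hCₕdef
  have hg' : ∀ (Q : Ideal C) [Q.IsPrime], h ∉ Q → IsRegularLocalRing (Localization.AtPrime Q) := by
    intro Q _ hhQ
    apply hg Q
    intro hgQ
    exact hhQ (Q.mul_mem_right (D a₀) hgQ)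
  haveI hCₕreg : IsRegularRing Cₕ := isRegularRing_of_isLocalization_away hg' Cₕ
  letI intAlgCₕ : Algebra ℤ Cₕ := Ring.toIntAlgebra _
  letI intModCₕ : Module ℤ Cₕ := AddCommGroup.toIntModule _
  obtain ⟨D', hD'⟩ := exists_derivation_extend_of_isLocalization ℤ Cₕ (Submonoid.powers h) D
  have hunit : IsUnit (D' (algebraMap C Cₕ a₀)) := by
    rw [hD']
    exact isUnit_of_dvd_unit (map_dvd _ (dvd_mul_left (D a₀) g))
      (IsLocalization.Away.algebraMap_isUnit h)
  -- Stacks 07PG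
  set P : Cₕ[X] := X ^ (p ^ m) - Polynomial.C (algebraMap C Cₕ a₀) with hPdef
  haveI hT : IsRegularRing (AdjoinRoot P) :=
    isRegularRing_adjoinRoot_X_pow_sub_C_of_derivation D' _ hunit (p ^ m)
  -- `Cₕ → F → (FractionRing A)`
  have hhF : IsUnit (algebraMap C F h) :=
    IsUnit.mk0 _ fun h0 => hh0 ((IsFractionRing.injective C F) (by rw [h0, map_zero]))
  letI algCₕF : Algebra Cₕ F := (IsLocalization.Away.lift h hhF).toAlgebra
  letI algCₕK : Algebra Cₕ (FractionRing A) := ((algebraMap F (FractionRing A)).comp (algebraMap Cₕ F)).toAlgebra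
  haveI : IsScalarTower Cₕ F (FractionRing A) := IsScalarTower.of_algebraMap_eq fun _ => rfl
  have hCₕF : ∀ c : C, algebraMap Cₕ F (algebraMap C Cₕ c) = algebraMap C F c :=
    IsLocalization.Away.lift_eq h hhF
  have hinjCₕF : Function.Injective (algebraMap Cₕ F) := by
    show Function.Injective (IsLocalization.Away.lift h hhF)
    rw [IsLocalization.Away.lift, IsLocalization.lift_injective_iff]
    intro c₁ c₂
    constructor
    · intro hc
      rw [(IsLocalization.injective Cₕ (powers_le_nonZeroDivisors_of_noZeroDivisors hh0)) hc]
    · intro hc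
      rw [(IsFractionRing.injective C F) hc]
  have hmap : minpoly F x = P.map (algebraMap Cₕ F) := by
    rw [hmin, hPdef, Polynomial.map_sub, Polynomial.map_pow, Polynomial.map_X, Polynomial.map_C,
      hCₕF, ha₀F]
  have hx0 : P.eval₂ (algebraMap Cₕ (FractionRing A)) x = 0 := by
    rw [hPdef, Polynomial.eval₂_sub, Polynomial.eval₂_X_pow, Polynomial.eval₂_C,
      IsScalarTower.algebraMap_apply Cₕ F (FractionRing A), hCₕF, ha₀F, haK]
    exact sub_self _
  set φ := AdjoinRoot.lift (algebraMap Cₕ (FractionRing A)) x hx0 with hφdef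
  have hφ : Function.Injective φ :=
    AdjoinRoot.lift_injective_of_minpoly_eq_map hinjCₕF x P
      (Polynomial.monic_X_pow_sub_C _ (pow_ne_zero m hp.ne_zero)) hmap hx0
  -- `C ⊆ C'`, `x ∈ C'`
  have hCC' : C ≤ C' := fun y hy =>
    ⟨hy.1, (IntermediateField.mem_restrictScalars (FractionRing R)).mpr
      ((IntermediateField.adjoin F {x}).algebraMap_mem ⟨y, hy.2⟩)⟩
  set incl : C →+* C' := (Subalgebra.inclusion hCC').toRingHom with hincl
  have hincl_val : ∀ c : C, ((incl c : C') : (FractionRing A)) = (c : (FractionRing A)) := fun _ => rfl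
  have hxC' : x ∈ C' :=
    ⟨hxA, (IntermediateField.mem_restrictScalars (FractionRing R)).mpr (IntermediateField.mem_adjoin_simple_self F x)⟩
  set x' : C' := ⟨x, hxC'⟩ with hx'def
  have hx'pow : x' ^ (p ^ m) = incl a₀ := Subtype.ext haK
  -- common denominator
  haveI : IsNoetherianRing R := inferInstance
  obtain ⟨c', hc'0, hc'⟩ := exists_smul_interSubalgebra_adjoin_le (R := R) (A := A) F hxint
  have hinjRC' : Function.Injective (algebraMap R C') := fun r₁ r₂ hr =>
    FaithfulSMul.algebraMap_injective R (FractionRing A) (congrArg Subtype.val hr)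
  have hinjincl : Function.Injective incl := Subalgebra.inclusion_injective hCC'
  refine ⟨algebraMap R C' c' * incl h, mul_ne_zero ((map_ne_zero_iff _ hinjRC').mpr hc'0)
    ((map_ne_zero_iff _ hinjincl).mpr hh0), fun Q _ hfQ => ?_⟩
  have hc'Q : algebraMap R C' c' ∉ Q := fun hq => hfQ (Q.mul_mem_right _ hq)
  have hhQ : incl h ∉ Q := fun hq => hfQ (Q.mul_mem_left _ hq)
  set W := Localization.AtPrime Q with hWdef
  -- `ψ : T → W`
  have hunitW : IsUnit ((algebraMap C' W).comp incl h) :=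
    IsLocalization.map_units W (⟨incl h, hhQ⟩ : Q.primeCompl)
  set ψ₀ : Cₕ →+* W := IsLocalization.Away.lift h hunitW with hψ₀def
  have hψ₀ : ∀ c : C, ψ₀ (algebraMap C Cₕ c) = algebraMap C' W (incl c) :=
    IsLocalization.Away.lift_eq h hunitW
  have hxψ : P.eval₂ ψ₀ (algebraMap C' W x') = 0 := by
    rw [hPdef]
    change Polynomial.eval₂RingHom ψ₀ (algebraMap C' W x') (X ^ (p ^ m) - Polynomial.C _) = 0
    rw [map_sub, map_pow, Polynomial.coe_eval₂RingHom, Polynomial.eval₂_X, Polynomial.eval₂_C, hψ₀,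
      ← map_pow, hx'pow]
    exact sub_self _
  set ψ := AdjoinRoot.lift ψ₀ (algebraMap C' W x') hxψ with hψdef
  -- `ι : W → (FractionRing A)`
  have hunitsK : ∀ y : Q.primeCompl, IsUnit (algebraMap C' (FractionRing A) y) := fun y =>
    IsUnit.mk0 _ fun h0 => y.2 (by
      have : (y : C') = 0 := Subtype.ext h0
      rw [this]; exact Q.zero_mem)
  set ι : W →+* (FractionRing A) := IsLocalization.lift hunitsK with hιdef
  have hι : ∀ z : C', ι (algebraMap C' W z) = (z : (FractionRing A)) := IsLocalization.lift_eq hunitsK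
  -- `ι ∘ ψ = φ`
  have hιψ₀ : ι.comp ψ₀ = algebraMap Cₕ (FractionRing A) := by
    refine IsLocalization.ringHom_ext (Submonoid.powers h) ?_
    ext c
    rw [RingHom.comp_apply, RingHom.comp_apply, hψ₀, hι, hincl_val, RingHom.comp_apply,
      IsScalarTower.algebraMap_apply Cₕ F (FractionRing A), hCₕF]
    rfl
  have hcomp : ι.comp ψ = φ := by
    apply Ideal.Quotient.ringHom_ext
    refine Polynomial.ringHom_ext (fun c => ?_) ?_
    · show ι (ψ (AdjoinRoot.of P c)) = φ (AdjoinRoot.of P c)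
      rw [hψdef, hφdef, AdjoinRoot.lift_of, AdjoinRoot.lift_of, ← RingHom.comp_apply, hιψ₀]
    · show ι (ψ (AdjoinRoot.root P)) = φ (AdjoinRoot.root P)
      rw [hψdef, hφdef, AdjoinRoot.lift_root, AdjoinRoot.lift_root, hι]
  -- every element of `W` is `ψ(t)/ψ(u)`
  have hkey : ∀ (z : C') (q : C[X]), Polynomial.aeval x q = algebraMap R (FractionRing A) c' * (z : (FractionRing A)) →
      ψ (AdjoinRoot.mk P (q.map (algebraMap C Cₕ))) = algebraMap C' W (algebraMap R C' c' * z) := by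
    intro z q hq
    rw [hψdef, AdjoinRoot.lift_mk, Polynomial.eval₂_map]
    have h1 : ψ₀.comp (algebraMap C Cₕ) = (algebraMap C' W).comp incl := by
      ext c; exact hψ₀ c
    rw [h1, ← Polynomial.hom_eval₂]
    congr 1
    apply Subtype.ext
    show ((q.eval₂ incl x' : C') : (FractionRing A)) = algebraMap R (FractionRing A) c' * (z : (FractionRing A))
    rw [← hq, show ((q.eval₂ incl x' : C') : (FractionRing A)) = (algebraMap C' (FractionRing A)) (q.eval₂ incl x') from rfl,
      Polynomial.hom_eval₂, Polynomial.aeval_def]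
    rfl
  have hsurj : ∀ w : W, ∃ t u : AdjoinRoot P, ψ u ∉ maximalIdeal W ∧ w * ψ u = ψ t := by
    intro w
    obtain ⟨⟨y, v⟩, rfl⟩ := IsLocalization.mk'_surjective Q.primeCompl w
    obtain ⟨qy, hqy⟩ := Algebra.adjoin_mem_exists_aeval C x (hc' (y : (FractionRing A)) y.2)
    obtain ⟨qv, hqv⟩ := Algebra.adjoin_mem_exists_aeval C x (hc' ((v : C') : (FractionRing A)) (v : C').2)
    refine ⟨AdjoinRoot.mk P (qy.map (algebraMap C Cₕ)), AdjoinRoot.mk P (qv.map (algebraMap C Cₕ)),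
      ?_, ?_⟩
    · rw [hkey (v : C') qv hqv, IsLocalization.AtPrime.to_map_mem_maximal_iff W Q]
      exact fun hmem => (‹Q.IsPrime›.mem_or_mem hmem).elim hc'Q v.2
    · rw [hkey (v : C') qv hqv, hkey y qy hqy, map_mul, map_mul, ← mul_assoc,
        mul_right_comm, IsLocalization.mk'_spec]
      ring
  exact isRegularLocalRing_of_dominated ψ φ ι hφ hcomp hsurj

end Radical

/-! ## The climb and the assembly -/

section Climb

variable {R A : Type u} [CommRing R] [IsDomain R] [CommRing A] [IsDomain A]
  [Algebra R A] [FaithfulSMul R A] [Module.Finite R A] [Algebra (FractionRing R) (FractionRing A)]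
  [IsScalarTower R (FractionRing R) (FractionRing A)]


/-- `Frac A` is a finite extension of `Frac R` (spanned by the images of `R`-module generators of
`A`, denominators taken in `R`). [folklore] -/
theorem finiteDimensional_fractionRing_of_finite :
    FiniteDimensional (FractionRing R) (FractionRing A) := by
  haveI : FaithfulSMul R (FractionRing A) := FractionRing.instFaithfulSMul R A
  classical
  obtain ⟨T, hT⟩ := Module.Finite.fg_top (R := R) (M := A)
  let f : A →ₗ[R] FractionRing A := (IsScalarTower.toAlgHom R A (FractionRing A)).toLinearMap
  refine Module.finite_def.mpr ⟨T.image f, ?_⟩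
  rw [eq_top_iff]
  rintro y -
  obtain ⟨a, s, hs0, hys⟩ := exists_mul_algebraMap_eq_of_finite (R := R) y
  have ha : f a ∈ Submodule.span (FractionRing R)
      ((T.image f : Finset (FractionRing A)) : Set (FractionRing A)) := by
    have h1 : a ∈ Submodule.span R (T : Set A) := by rw [hT]; trivial
    have h2 := Submodule.mem_map_of_mem (f := f) h1
    rw [Submodule.map_span] at h2
    rw [Finset.coe_image]
    exact Submodule.span_le_restrictScalars R (FractionRing R) _ h2
  have hsK : algebraMap R (FractionRing A) s ≠ 0 :=
    (map_ne_zero_iff _ (FaithfulSMul.algebraMap_injective R _)).mpr hs0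
  have hy : y = (algebraMap R (FractionRing R) s)⁻¹ • f a := by
    rw [Algebra.smul_def, map_inv₀, ← IsScalarTower.algebraMap_apply]
    show y = (algebraMap R (FractionRing A) s)⁻¹ * algebraMap A (FractionRing A) a
    rw [← hys]
    field_simp
  rw [hy]
  exact Submodule.smul_mem _ _ ha

/-- **The climb of Stacks 07PI** ("arguing by induction on `[K : K₀]` we may assume there exists
`A₀ ⊂ B ⊂ A` such that `B` is J-0 and `K/M` has no nontrivial subextensions … If not, then
`K = M[z]/(z^p - b)` …"): starting from an intermediate field `F ⊇ K_s` with `A ∩ F` J-0, reach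
`A ∩ K` by radical steps. [cite: StacksProject, Tag 07PI] -/
theorem exists_ne_zero_forall_isRegularLocalRing_interSubalgebra_top_of_le
    [IsRegularLocalRing R] [IsAdicComplete (maximalIdeal R) R] (p : ℕ) [Fact p.Prime]
    [CharP (FractionRing A) p] (Fs : IntermediateField (FractionRing R) (FractionRing A))
    [IsPurelyInseparable Fs (FractionRing A)] :
    ∀ (n : ℕ) (F : IntermediateField (FractionRing R) (FractionRing A)), Fs ≤ F →
      Module.finrank F (FractionRing A) = n →
      (∃ g : (((IsScalarTower.toAlgHom R A (FractionRing A)).range ⊓ Subalgebra.restrictScalars R (IntermediateField.toSubalgebra F) : Subalgebra R (FractionRing A))), g ≠ 0 ∧ ∀ (Q : Ideal ((((IsScalarTower.toAlgHom R A (FractionRing A)).range ⊓ Subalgebra.restrictScalars R (IntermediateField.toSubalgebra F) : Subalgebra R (FractionRing A))))) [Q.IsPrime], g ∉ Q →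
      IsRegularLocalRing (Localization.AtPrime Q)) →
      (∃ g : (((IsScalarTower.toAlgHom R A (FractionRing A)).range ⊓ Subalgebra.restrictScalars R (IntermediateField.toSubalgebra (⊤ : IntermediateField (FractionRing R) (FractionRing A))) : Subalgebra R (FractionRing A))), g ≠ 0 ∧ ∀ (Q : Ideal ((((IsScalarTower.toAlgHom R A (FractionRing A)).range ⊓ Subalgebra.restrictScalars R (IntermediateField.toSubalgebra (⊤ : IntermediateField (FractionRing R) (FractionRing A))) : Subalgebra R (FractionRing A))))) [Q.IsPrime], g ∉ Q →
      IsRegularLocalRing (Localization.AtPrime Q)) := by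
  haveI : FaithfulSMul R (FractionRing A) := FractionRing.instFaithfulSMul R A
  have hp : p.Prime := Fact.out
  haveI : FiniteDimensional (FractionRing R) (FractionRing A) :=
    finiteDimensional_fractionRing_of_finite (R := R) (A := A)
  intro n
  induction n using Nat.strong_induction_on with
  | _ n ih =>
    intro F hFs hn hF
    by_cases hFtop : F = ⊤
    · subst hFtop
      exact hF
    -- an element of `A` (inside `Frac A`) outside `F`
    obtain ⟨y, -, hyF⟩ := SetLike.exists_of_lt (lt_top_iff_ne_top.mpr hFtop)
    obtain ⟨a, s, hs0, hys⟩ := exists_mul_algebraMap_eq_of_finite (R := R) y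
    set x := algebraMap A (FractionRing A) a with hxdef
    have hxA : x ∈ (IsScalarTower.toAlgHom R A (FractionRing A)).range := ⟨a, rfl⟩
    have hsF : algebraMap R (FractionRing A) s ∈ F := by
      rw [IsScalarTower.algebraMap_apply R (FractionRing R) (FractionRing A)]
      exact F.algebraMap_mem _
    have hsK : algebraMap R (FractionRing A) s ≠ 0 :=
      (map_ne_zero_iff _ (FaithfulSMul.algebraMap_injective R _)).mpr hs0
    have hxF : x ∉ F := by
      intro hxF
      apply hyF
      have : y = x * (algebraMap R (FractionRing A) s)⁻¹ := by
        rw [← hys, mul_inv_cancel_right₀ hsK]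
      rw [this]
      exact F.mul_mem hxF (F.inv_mem hsF)
    -- `K/F` is purely inseparable; minimal polynomial `X^{p^m} - a'`
    haveI : CharP F p := (algebraMap F (FractionRing A)).charP (algebraMap F (FractionRing A)).injective p
    haveI : IsPurelyInseparable F (FractionRing A) := by
      refine (isPurelyInseparable_iff_pow_mem F p).mpr fun z => ?_
      obtain ⟨k, w, hw⟩ := IsPurelyInseparable.pow_mem Fs p z
      exact ⟨k, ⟨(w : FractionRing A), hFs w.2⟩, hw⟩
    obtain ⟨m, a', hmin⟩ := IsPurelyInseparable.minpoly_eq_X_pow_sub_C F p x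
    have hxint : IsIntegral F x := IsIntegral.of_finite F x
    have hm : m ≠ 0 := by
      rintro rfl
      apply hxF
      have hdeg : (minpoly F x).natDegree = 1 := by
        rw [hmin, pow_zero, pow_one, Polynomial.natDegree_X_sub_C]
      obtain ⟨z, hz⟩ := minpoly.natDegree_eq_one_iff.mp hdeg
      rw [← hz]
      exact z.2
    have ha' : ∀ c : F, c ^ p ≠ a' := fun c =>
      pow_ne_of_irreducible_X_pow_sub_C (hmin ▸ minpoly.irreducible hxint)
        (dvd_pow_self p hm) hp.one_lt.ne' c
    -- the radical step
    have hF' := exists_ne_zero_forall_isRegularLocalRing_interSubalgebra_adjoin (R := R) (A := A)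
      p F hF hxA m a' hmin ha'
    -- induction hypothesis for `F' = F(x)`
    let F' : IntermediateField (FractionRing R) (FractionRing A) :=
      (IntermediateField.adjoin F {x}).restrictScalars (FractionRing R)
    have hFF' : F ≤ F' := fun z hz => (IntermediateField.adjoin F {x}).algebraMap_mem ⟨z, hz⟩
    haveI : FiniteDimensional F (IntermediateField.adjoin F {x}) :=
      IntermediateField.adjoin.finiteDimensional hxint
    have hdeg : Module.finrank F (IntermediateField.adjoin F {x}) = p ^ m := by
      rw [IntermediateField.adjoin.finrank hxint, hmin, Polynomial.natDegree_X_pow_sub_C]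
    have hmul := Module.finrank_mul_finrank F (IntermediateField.adjoin F {x}) (FractionRing A)
    have hpos : 0 < Module.finrank (IntermediateField.adjoin F {x}) (FractionRing A) :=
      Module.finrank_pos
    have hlt : Module.finrank F' (FractionRing A) < n := by
      change Module.finrank (IntermediateField.adjoin F {x}) (FractionRing A) < n
      rw [← hn, ← hmul, hdeg]
      have h2 : 2 ≤ p ^ m := by
        calc 2 ≤ p := hp.two_le
          _ = p ^ 1 := (pow_one p).symm
          _ ≤ p ^ m := Nat.pow_le_pow_right hp.pos (Nat.one_le_iff_ne_zero.mpr hm)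
      nlinarith
    exact ih _ hlt F' (hFs.trans hFF') rfl hF'

end Climb

/-! ## The assembly -/

section Assembly

variable {R A : Type u} [CommRing R] [IsDomain R] [CommRing A] [IsDomain A]
  [Algebra R A] [FaithfulSMul R A] [Module.Finite R A]

/-- **Stacks 07PI for `A` finite over a complete regular local subring `R`**: `A` is J-0 (the
separable step up to `A ∩ K_s`, then the climb; in characteristic `0`, `K_s = Frac A`).
[cite: StacksProject, Tag 07PI] -/
theorem exists_ne_zero_forall_isRegularLocalRing_of_finite_regular
    [IsRegularLocalRing R] [IsAdicComplete (maximalIdeal R) R] :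
    ∃ f : A, f ≠ 0 ∧ ∀ (Q : Ideal A) [Q.IsPrime], f ∉ Q →
      IsRegularLocalRing (Localization.AtPrime Q) := by
  haveI : FaithfulSMul R (FractionRing A) := FractionRing.instFaithfulSMul R A
  letI : Algebra (FractionRing R) (FractionRing A) := FractionRing.liftAlgebra R (FractionRing A)
  haveI : IsRegularRing R := isRegularRing_of_isRegularLocalRing R
  haveI : FiniteDimensional (FractionRing R) (FractionRing A) :=
    finiteDimensional_fractionRing_of_finite (R := R) (A := A)
  have hKs := exists_ne_zero_forall_isRegularLocalRing_interSubalgebra_separableClosure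
    (R := R) (A := A)
  -- reach `A ∩ K`, according to the characteristic
  have htop : (∃ g : (((IsScalarTower.toAlgHom R A (FractionRing A)).range ⊓ Subalgebra.restrictScalars R (IntermediateField.toSubalgebra (⊤ : IntermediateField (FractionRing R) (FractionRing A))) : Subalgebra R (FractionRing A))), g ≠ 0 ∧ ∀ (Q : Ideal ((((IsScalarTower.toAlgHom R A (FractionRing A)).range ⊓ Subalgebra.restrictScalars R (IntermediateField.toSubalgebra (⊤ : IntermediateField (FractionRing R) (FractionRing A))) : Subalgebra R (FractionRing A))))) [Q.IsPrime], g ∉ Q →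
      IsRegularLocalRing (Localization.AtPrime Q)) := by
    obtain ⟨p, hp⟩ := CharP.exists (FractionRing A)
    rcases CharP.char_is_prime_or_zero (FractionRing A) p with hprime | rfl
    · haveI := Fact.mk hprime
      haveI : IsPurelyInseparable (separableClosure (FractionRing R) (FractionRing A))
          (FractionRing A) :=
        separableClosure.isPurelyInseparable (FractionRing R) (FractionRing A)
      exact exists_ne_zero_forall_isRegularLocalRing_interSubalgebra_top_of_le (R := R) (A := A)
        p (separableClosure (FractionRing R) (FractionRing A)) _ _ le_rfl rfl hKs
    · haveI : CharZero (FractionRing A) := CharP.charP_to_charZero (FractionRing A)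
      haveI : CharZero (FractionRing R) :=
        (algebraMap (FractionRing R) (FractionRing A)).charZero
      haveI : Algebra.IsAlgebraic (FractionRing R) (FractionRing A) :=
        Algebra.IsAlgebraic.of_finite _ _
      haveI : Algebra.IsSeparable (FractionRing R) (FractionRing A) :=
        Algebra.IsAlgebraic.isSeparable_of_perfectField
      have heq : separableClosure (FractionRing R) (FractionRing A) = ⊤ :=
        (separableClosure.eq_top_iff _ _).mpr inferInstance
      have heq' : (((IsScalarTower.toAlgHom R A (FractionRing A)).range ⊓ Subalgebra.restrictScalars R (IntermediateField.toSubalgebra (separableClosure (FractionRing R) (FractionRing A))) : Subalgebra R (FractionRing A))) =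
          (((IsScalarTower.toAlgHom R A (FractionRing A)).range ⊓ Subalgebra.restrictScalars R (IntermediateField.toSubalgebra (⊤ : IntermediateField (FractionRing R) (FractionRing A))) : Subalgebra R (FractionRing A))) := by rw [heq]
      exact exists_ne_zero_forall_isRegularLocalRing_of_ringEquiv
        (Subalgebra.equivOfEq _ _ heq').toRingEquiv hKs
  -- `A ∩ Frac A = A`
  let eTop : (((IsScalarTower.toAlgHom R A (FractionRing A)).range ⊓ Subalgebra.restrictScalars R (IntermediateField.toSubalgebra (⊤ : IntermediateField (FractionRing R) (FractionRing A))) : Subalgebra R (FractionRing A))) ≃ₐ[R] A :=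
    (Subalgebra.equivOfEq _ _ (by
      ext y
      exact ⟨fun h => h.1, fun h => ⟨h, trivial⟩⟩)).trans
      (AlgEquiv.ofInjective (IsScalarTower.toAlgHom R A (FractionRing A))
        (IsFractionRing.injective A (FractionRing A))).symm
  exact exists_ne_zero_forall_isRegularLocalRing_of_ringEquiv eTop.toRingEquiv htop

end Assembly

/-! ## Stacks 07PI -/

/-- **Stacks, Tag 07PI: "Let `A` be a Noetherian complete local domain. Then `A` is J-0."** —
i.e. `Reg(Spec A)` contains a non-empty (basic) open: by Cohen's structure theorem in the form of
Matsumura Thm. 29.4 (iii) (`Matsumura1987_29_4_iii_holds`) `A` is finite over a complete regular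
local subring `A₀`, and `exists_ne_zero_forall_isRegularLocalRing_of_finite_regular` applies.
[cite: StacksProject, Tag 07PI] -/
theorem exists_ne_zero_forall_isRegularLocalRing_of_isAdicComplete (A : Type u) [CommRing A]
    [IsDomain A] [IsLocalRing A] [IsNoetherianRing A] [IsAdicComplete (maximalIdeal A) A] :
    ∃ f : A, f ≠ 0 ∧ ∀ (Q : Ideal A) [Q.IsPrime], f ∉ Q →
      IsRegularLocalRing (Localization.AtPrime Q) := by
  obtain ⟨A₀, hreg, hcomp, hfin⟩ := Matsumura1987_29_4_iii_holds A
  haveI := hreg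
  haveI := hcomp
  haveI := hfin
  haveI : FaithfulSMul A₀ A := (faithfulSMul_iff_algebraMap_injective A₀ A).mpr Subtype.val_injective
  exact exists_ne_zero_forall_isRegularLocalRing_of_finite_regular (R := A₀) (A := A)




end Literature.AlgebraicGeometry.Resolution
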